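import Summits.BirchSwinnertonDyer.BirchSwinnertonDyer.Theorems.ByReductionTypeAtTwoKatoFreeSandwichImageSplit
import Summits.BirchSwinnertonDyer.BirchSwinnertonDyer.Theorems.ByReductionTypeAtTwoOrdMissingLowerBoundOfLambdaHalf
import Summits.BirchSwinnertonDyer.BirchSwinnertonDyer.Theses.ByReductionTypeAtTwo
import Summits.BirchSwinnertonDyer.BirchSwinnertonDyer.Theses.TwoAdicConverse
import HarnessLib

/-!
# TRIAGE r1 seat 2/2, GEN 14 — crux `OrdMissingLowerBoundAtTwo` (stmt-BirchSwinnertonDyer-19577, K4 `ByReductionTypeAtTwo`):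
# SLICE × IMAGE — what each branch of the λ-half 19556 buys K4, exactly

Refuter crux-triage companion (crux WORKFILE: elaborates on the farm, no `sorry`; nothing proposed, no Literature fact,
no `@[route_item]`; every `def` below is local to this namespace).  BSD is NOT proved by anything here; 19577 is NOT
closed; this seat LEADS nothing and ran no `ledger skeleton check`.

Inputs combined: (i) this seat's GEN 13 finding (`TRIAGE_r1_2_RankZeroSliceGen13.lean`): the picked line
`kato-free-lower-sandwich-two` (p668589) consumes crux 19556 `OrdLambdaHalfAtTwo` ONLY on its ANALYTIC-RANK-0 SLICE, and inside
K4 (mod PUB, Cassels, Abbes–Ullmo, T2, K4's Kato crux 19573) 19577 ⟺ that slice; (ii) lead g4's p671201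
(`…KatoFreeSandwichImageSplit.lean`): the line is IMAGE-LOCAL — at an `E[2]`-irreducible curve the λ-half is consumed AT THE
CURVE with no selector / Cassels / T2, on the reducible locus at the max-period member of the class.

Product (this file, kernel-checked):
* §0 the four quarter-statements (`…RankZeroIrr/Red` slices of 19556; `…Irr/Red` halves of 19577) and their bookkeeping;
* §1 ⇐ by image on the slice: 19577↾irr ⟸ PUB ∧ AU ∧ (19556 ↾ rank 0 ↾ irr) — NO Cassels, NO T2;
  19577↾red ⟸ PUB ∧ Cassels ∧ AU ∧ T2 ∧ (19556 ↾ rank 0 ↾ red) (p671201 §1 with the isogeny-stable class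
  «reducible ∧ analytic rank 0»);
* §2 ⇒ by image inside K4: PER CURVE at an `E[2]`-irreducible non-CM rank-0 good-ordinary `W` carrying the Kato half,
  `MissingLowerBoundAt W 2 ↔ LambdaHalfAtTwo W` (mod PUB, AU only) — the finest honest statement of «19577 = λ-half» —
  and the two `∀`-equivalences 19577↾irr ⟺ slice↾irr (mod PUB, Cassels, AU, 19573), 19577↾red ⟺ slice↾red (mod PUB,
  Cassels, AU, T2, 19573);
* §3 glue texts for a BY-IMAGE re-filing (the lead g4's reading «whichever branch of 19556 lands first closes the matching
  branch of 19577»), each closing AT ONCE, with the weakest λ-hypothesis each branch actually consumes.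
Pricing consequence only (the pen decides; D-0152): K4's good-ordinary descent crux is, modulo its own print and 19573,
EXACTLY (19556 ↾ rank 0 ↾ irr) ∧ (19556 ↾ rank 0 ↾ red); the irreducible quarter does not even need Cassels/T2.
-/

set_option autoImplicit false
set_option linter.dupNamespace false

noncomputable section

open scoped Classical MatrixGroups ModularForm

open CongruenceSubgroup WeierstrassCurve Literature.NumberTheory.EllipticCurves
  Literature.NumberTheory.EllipticCurves.ModularForms Literature.NumberTheory.EllipticCurves.Rank1Residual
  Literature.NumberTheory.EllipticCurves.Rank1Residual.Typed
  Literature.NumberTheory.EllipticCurves.Greenberg1999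
  Summit.BirchSwinnertonDyer.Rank1Residual.X1.MuLambda
  Summit.BirchSwinnertonDyer.Rank1Residual.X1.MuPart
  Summit.BirchSwinnertonDyer.Rank1Residual.X5
  Summit.BirchSwinnertonDyer.Rank1Residual.X5.O1
  Summit.BirchSwinnertonDyer.Rank1Residual
  Summit.BirchSwinnertonDyer.BirchSwinnertonDyer.Theorems.TwoAdicTwistConverse
  Summit.BirchSwinnertonDyer.BirchSwinnertonDyer.Theorems.EisensteinLowerBounds
  Summit.BirchSwinnertonDyer.BirchSwinnertonDyer.Theorems.EisensteinShaCurrency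
  Summit.BirchSwinnertonDyer.BirchSwinnertonDyer.Theorems.IsogenyMuShift
  Summit.BirchSwinnertonDyer.BirchSwinnertonDyer.Theorems.KatoFreeSandwich

namespace Summit.BirchSwinnertonDyer.BirchSwinnertonDyer.Cruxes.OrdMissingLowerBoundAtTwo.TriageR1Seat2Gen14

open Summit.BirchSwinnertonDyer.BirchSwinnertonDyer.Theorems
open Summit.BirchSwinnertonDyer.BirchSwinnertonDyer.Theses

/-! ## §0 The four quarter-statements and their bookkeeping -/

/-- GEN 13's slice, restated locally: 19556 at analytic rank 0. -/
def OrdLambdaHalfAtTwoRankZero : Prop :=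
  ∀ (W : WeierstrassCurve ℚ) [W.IsElliptic] [W.IsGloballyMinimal], ¬ W.HasCM → W.analyticRank = 0 →
    GoodOrd W 2 → TwoAdicTwistConverse.LambdaHalfAtTwo W

/-- The IRREDUCIBLE QUARTER of 19556: λ-half at every non-CM, analytic-rank-0, good-ordinary-at-2 `W` with `E[2]`
irreducible (= 19556's registered `stub_irreducibleResidual` restricted to analytic rank 0). -/
def OrdLambdaHalfAtTwoRankZeroIrr : Prop :=
  ∀ (W : WeierstrassCurve ℚ) [W.IsElliptic] [W.IsGloballyMinimal], ¬ W.HasCM → W.analyticRank = 0 →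
    GoodOrd W 2 → W.HasIrreducibleModPGaloisRep 2 → TwoAdicTwistConverse.LambdaHalfAtTwo W

/-- The REDUCIBLE QUARTER of 19556: λ-half at every non-CM, analytic-rank-0, good-ordinary-at-2 `W` with `E[2]`
reducible (the rank-0 part of the habitat of 19556's line `kato_determinant_greenberg_two`). -/
def OrdLambdaHalfAtTwoRankZeroRed : Prop :=
  ∀ (W : WeierstrassCurve ℚ) [W.IsElliptic] [W.IsGloballyMinimal], ¬ W.HasCM → W.analyticRank = 0 →
    GoodOrd W 2 → ¬ W.HasIrreducibleModPGaloisRep 2 → TwoAdicTwistConverse.LambdaHalfAtTwo W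

/-- The IRREDUCIBLE HALF of crux 19577. -/
def OrdMissingLowerBoundAtTwoIrr : Prop :=
  ∀ (W : WeierstrassCurve ℚ) [W.IsElliptic] [W.IsGloballyMinimal], ¬ W.HasCM → W.analyticRank = 0 →
    GoodOrd W 2 → W.HasIrreducibleModPGaloisRep 2 → MissingLowerBoundAt W 2

/-- The REDUCIBLE HALF of crux 19577. -/
def OrdMissingLowerBoundAtTwoRed : Prop :=
  ∀ (W : WeierstrassCurve ℚ) [W.IsElliptic] [W.IsGloballyMinimal], ¬ W.HasCM → W.analyticRank = 0 →
    GoodOrd W 2 → ¬ W.HasIrreducibleModPGaloisRep 2 → MissingLowerBoundAt W 2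

/-- Slice ⟺ its two quarters (excluded middle on the image). -/
theorem sliceRankZero_iff_irr_and_red :
    OrdLambdaHalfAtTwoRankZero ↔ (OrdLambdaHalfAtTwoRankZeroIrr ∧ OrdLambdaHalfAtTwoRankZeroRed) := by
  constructor
  · intro h
    exact ⟨fun W _ _ hcm hr hgo _ => h W hcm hr hgo, fun W _ _ hcm hr hgo _ => h W hcm hr hgo⟩
  · rintro ⟨hI, hR⟩ W _ _ hcm hr hgo
    by_cases hirr : W.HasIrreducibleModPGaloisRep 2
    · exact hI W hcm hr hgo hirr
    · exact hR W hcm hr hgo hirr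

/-- Route decl of 19577 ⟺ its two halves (excluded middle on the image). -/
theorem routeDecl_iff_irr_and_red :
    ByReductionTypeAtTwo.OrdMissingLowerBoundAtTwo ↔ (OrdMissingLowerBoundAtTwoIrr ∧ OrdMissingLowerBoundAtTwoRed) := by
  constructor
  · intro h
    exact ⟨fun W _ _ hcm hr hgo _ => h W hcm hr hgo, fun W _ _ hcm hr hgo _ => h W hcm hr hgo⟩
  · rintro ⟨hI, hR⟩ W _ _ hcm hr hgo
    by_cases hirr : W.HasIrreducibleModPGaloisRep 2
    · exact hI W hcm hr hgo hirr
    · exact hR W hcm hr hgo hirr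

/-- 19556's registered `stub_irreducibleResidual` (rank-free) ⟹ the irreducible quarter. -/
theorem sliceIrr_of_lambdaHalfIrr
    (hΛirr : ∀ (W : WeierstrassCurve ℚ) [W.IsElliptic] [W.IsGloballyMinimal], ¬ W.HasCM → GoodOrd W 2 →
      W.HasIrreducibleModPGaloisRep 2 → TwoAdicTwistConverse.LambdaHalfAtTwo W) :
    OrdLambdaHalfAtTwoRankZeroIrr :=
  fun W _ _ hcm _ hgo hirr => hΛirr W hcm hgo hirr

/-- The reducible-locus λ-half (rank-free, the conclusion of 19556's line on its habitat) ⟹ the reducible quarter. -/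
theorem sliceRed_of_lambdaHalfRed
    (hΛred : ∀ (W : WeierstrassCurve ℚ) [W.IsElliptic] [W.IsGloballyMinimal], ¬ W.HasCM → GoodOrd W 2 →
      ¬ W.HasIrreducibleModPGaloisRep 2 → TwoAdicTwistConverse.LambdaHalfAtTwo W) :
    OrdLambdaHalfAtTwoRankZeroRed :=
  fun W _ _ hcm _ hgo hred => hΛred W hcm hgo hred

/-- 19556 itself (Theses spelling, S3's route decl) ⟹ both quarters. -/
theorem quarters_of_theses (hΛ : TwoAdicConverse.OrdLambdaHalfAtTwo) :
    OrdLambdaHalfAtTwoRankZeroIrr ∧ OrdLambdaHalfAtTwoRankZeroRed :=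
  ⟨fun W _ _ hcm _ hgo _ => hΛ W hcm hgo, fun W _ _ hcm _ hgo _ => hΛ W hcm hgo⟩

/-! ## §1 ⇐ by image on the slice (the line; 19573 is NOT used) -/

/-- **Irreducible half of 19577 ⟸ PUB ∧ Abbes–Ullmo ∧ irreducible quarter of 19556.**  No Cassels, no T2, no selector
(p671201 §2 per curve, the λ-half applied at `W` itself with its rank-0 witness). Conditional; closes nothing.
[cite: Kato2004Asterisque, Thm. 17.4] [cite: AbbesUllmo1996, Thm. A] -/
theorem irrHalf_of_sliceIrr
    (hPub : Literature.Uncategorized.OrdPublishedInputsAtTwo) (hAU : abbesUllmo_not_dvd_maninConstant_of_not_dvd_level)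
    (hΛ0I : OrdLambdaHalfAtTwoRankZeroIrr) : OrdMissingLowerBoundAtTwoIrr :=
  fun W _ _ hcm hr hgo hirr =>
    missingLowerBoundAt_two_of_irr_of_lambdaHalfAt hPub hAU W hr hgo hirr (hΛ0I W hcm hr hgo hirr)

/-- **Reducible half of 19577 ⟸ PUB ∧ Cassels ∧ Abbes–Ullmo ∧ T2 ∧ reducible quarter of 19556** — p671201 §1 with the
isogeny-stable class `C W := ¬ E[2] irreducible ∧ analyticRank W = 0` (reducibility: `not_hasIrreducibleModPGaloisRep_of_isIsogenous`;
analytic rank: `analyticRank_eq_of_isIsogenous'`), so the λ-half is consumed at a rank-0 reducible member only.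
Conditional; closes nothing. [cite: Kato2004Asterisque, Thm. 17.4] [cite: Stevens1989, §2] [cite: AbbesUllmo1996, Thm. A] -/
theorem redHalf_of_sliceRed
    (hPub : Literature.Uncategorized.OrdPublishedInputsAtTwo) (hCassels : bsdRHS_eq_of_isIsogenous)
    (hAU : abbesUllmo_not_dvd_maninConstant_of_not_dvd_level) (hex : exists_optimal_gamma1ParametrizationData)
    (hΛ0R : OrdLambdaHalfAtTwoRankZeroRed) : OrdMissingLowerBoundAtTwoRed :=
  fun W _ _ hcm hr hgo hred =>
    missingLowerBoundAt_two_on_of_lambdaHalf_on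
      (fun V => ¬ V.HasIrreducibleModPGaloisRep 2 ∧ V.analyticRank = 0)
      (fun V V'' _ _ hiso hV =>
        ⟨Rank1Residual.not_hasIrreducibleModPGaloisRep_of_isIsogenous hiso hV.1,
          by rw [← analyticRank_eq_of_isIsogenous' hiso]; exact hV.2⟩)
      hPub hCassels hAU hex
      (fun V _ _ hcmV hgoV hCV => hΛ0R V hcmV hCV.2 hgoV hCV.1)
      W hcm hr hgo ⟨hred, hr⟩

/-- **The ROUTE DECL of 19577 from the two quarters** (PUB ∧ Cassels ∧ AU ∧ T2 ∧ slice↾irr ∧ slice↾red): p668589 /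
p671201 §4 with BOTH weakenings (rank 0 and image) applied to the λ-input.  Conditional; closes nothing.
[cite: Kato2004Asterisque, Thm. 17.4] [cite: Stevens1989, §2] -/
theorem routeDecl_of_sliceIrr_of_sliceRed
    (hPub : Literature.Uncategorized.OrdPublishedInputsAtTwo) (hCassels : bsdRHS_eq_of_isIsogenous)
    (hAU : abbesUllmo_not_dvd_maninConstant_of_not_dvd_level) (hex : exists_optimal_gamma1ParametrizationData)
    (hΛ0I : OrdLambdaHalfAtTwoRankZeroIrr) (hΛ0R : OrdLambdaHalfAtTwoRankZeroRed) :
    ByReductionTypeAtTwo.OrdMissingLowerBoundAtTwo :=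
  routeDecl_iff_irr_and_red.mpr ⟨irrHalf_of_sliceIrr hPub hAU hΛ0I, redHalf_of_sliceRed hPub hCassels hAU hex hΛ0R⟩

/-! ## §2 ⇒ by image, inside K4 (uses the Kato half; AU/T2 NOT used in this direction) -/

/-- **Per curve, at an `E[2]`-IRREDUCIBLE non-CM rank-0 good-ordinary `W` that carries the Kato half AT `W`:
`MissingLowerBoundAt W 2 ↔ LambdaHalfAtTwo W`** modulo PUB and Abbes–Ullmo only.  (⇒: ord-3 GEN 5's
`lambdaHalfAtTwo_of_katoHalf_of_missingLowerBoundAt` — descent inequality ∧ Kato half ⇒ IMC₂ ⇒ λ-half; ⇐: p671201 §2.)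
This is the finest honest form of «K4's descent crux IS the λ-inequality» on the big-image/irreducible locus (e.g. under
19573's `stub_surj` regime).  Conditional; closes nothing.
[cite: Kato2004Asterisque, Thm. 17.4 (1)(2) (p. 273)] [cite: GreenbergLNM1716, Thm. 4.1 (p. 102)] [cite: AbbesUllmo1996, Thm. A] -/
theorem missingLowerBoundAt_two_iff_lambdaHalfAtTwo_of_irr_of_katoHalfAt
    (hPub : Literature.Uncategorized.OrdPublishedInputsAtTwo) (hAU : abbesUllmo_not_dvd_maninConstant_of_not_dvd_level)
    (W : WeierstrassCurve ℚ) [W.IsElliptic] [W.IsGloballyMinimal] (hr : W.analyticRank = 0) (hgo : GoodOrd W 2)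
    (hirr : W.HasIrreducibleModPGaloisRep 2) (hKW : MainConjectureLowerDivisibilityAtTwoOrd W) :
    MissingLowerBoundAt W 2 ↔ TwoAdicTwistConverse.LambdaHalfAtTwo W := by
  have hPub' := hPub
  obtain ⟨hmod, hGZK, h17, hGr⟩ := hPub'
  exact ⟨fun hL => lambdaHalfAtTwo_of_katoHalf_of_missingLowerBoundAt W hmod hGZK (h17 W)
      (twoAdicEulerCharRankZero_zero_of_greenberg W hGr) hgo hr hKW hL,
    fun hΛ => missingLowerBoundAt_two_of_irr_of_lambdaHalfAt hPub hAU W hr hgo hirr hΛ⟩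

/-- The same per-curve equivalence with the Kato half given UP TO ISOGENY (19573's shape), moved onto `W` by
`katoHalf_isogenyInvariant` (PRINT: Cassels).  Conditional; closes nothing.
[cite: Kato2004Asterisque, Thm. 17.4 (1)(2) (p. 273)] [cite: MilneADT2006, Thm. I.7.3] -/
theorem missingLowerBoundAt_two_iff_lambdaHalfAtTwo_of_irr_of_katoHalfIso
    (hPub : Literature.Uncategorized.OrdPublishedInputsAtTwo) (hCassels : bsdRHS_eq_of_isIsogenous)
    (hAU : abbesUllmo_not_dvd_maninConstant_of_not_dvd_level)
    (W : WeierstrassCurve ℚ) [W.IsElliptic] [W.IsGloballyMinimal] (hr : W.analyticRank = 0) (hgo : GoodOrd W 2)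
    (hirr : W.HasIrreducibleModPGaloisRep 2)
    (hK : ∃ (W' : WeierstrassCurve ℚ) (_ : W'.IsElliptic) (_ : W'.IsGloballyMinimal),
      IsIsogenous W W' ∧ MainConjectureLowerDivisibilityAtTwoOrd W') :
    MissingLowerBoundAt W 2 ↔ TwoAdicTwistConverse.LambdaHalfAtTwo W := by
  obtain ⟨W', _, _, hiso', hK'⟩ := hK
  exact missingLowerBoundAt_two_iff_lambdaHalfAtTwo_of_irr_of_katoHalfAt hPub hAU W hr hgo hirr
    (katoHalf_isogenyInvariant hPub hCassels hiso' hgo hr hK')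

/-- ⇒ on the irreducible locus: 19573 ∧ 19577↾irr ⟹ slice↾irr (PRINT: PUB, Cassels). -/
theorem sliceIrr_of_katoHalfIso_of_irrHalf
    (hPub : Literature.Uncategorized.OrdPublishedInputsAtTwo) (hCassels : bsdRHS_eq_of_isIsogenous)
    (hK : ByReductionTypeAtTwo.OrdKatoHalfAtTwoIso) (hL : OrdMissingLowerBoundAtTwoIrr) :
    OrdLambdaHalfAtTwoRankZeroIrr := by
  have hPub' := hPub
  obtain ⟨hmod, hGZK, h17, hGr⟩ := hPub'
  intro W _ _ hcm hr hgo hirr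
  obtain ⟨W', _, _, hiso', hK'⟩ := hK W hcm hr hgo
  exact lambdaHalfAtTwo_of_katoHalf_of_missingLowerBoundAt W hmod hGZK (h17 W)
    (twoAdicEulerCharRankZero_zero_of_greenberg W hGr) hgo hr
    (katoHalf_isogenyInvariant hPub hCassels hiso' hgo hr hK') (hL W hcm hr hgo hirr)

/-- ⇒ on the reducible locus: 19573 ∧ 19577↾red ⟹ slice↾red (PRINT: PUB, Cassels). -/
theorem sliceRed_of_katoHalfIso_of_redHalf
    (hPub : Literature.Uncategorized.OrdPublishedInputsAtTwo) (hCassels : bsdRHS_eq_of_isIsogenous)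
    (hK : ByReductionTypeAtTwo.OrdKatoHalfAtTwoIso) (hL : OrdMissingLowerBoundAtTwoRed) :
    OrdLambdaHalfAtTwoRankZeroRed := by
  have hPub' := hPub
  obtain ⟨hmod, hGZK, h17, hGr⟩ := hPub'
  intro W _ _ hcm hr hgo hred
  obtain ⟨W', _, _, hiso', hK'⟩ := hK W hcm hr hgo
  exact lambdaHalfAtTwo_of_katoHalf_of_missingLowerBoundAt W hmod hGZK (h17 W)
    (twoAdicEulerCharRankZero_zero_of_greenberg W hGr) hgo hr
    (katoHalf_isogenyInvariant hPub hCassels hiso' hgo hr hK') (hL W hcm hr hgo hred)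

/-- **Inside K4, 19577↾irr ⟺ (19556 ↾ rank 0 ↾ irr)** — modulo PUB (19149), Cassels (19567.1), Abbes–Ullmo and K4's
Kato crux 19573 (⇐ uses neither Cassels nor 19573; ⇒ does not use AU).  T2 appears NOWHERE for this half. -/
theorem irrHalf_iff_sliceIrr_inside_K4
    (hPub : ByReductionTypeAtTwo.OrdPublishedInputsAtTwo) (hIso : ByReductionTypeAtTwo.OrdIsoPublishedInputsAtTwo)
    (hAU : abbesUllmo_not_dvd_maninConstant_of_not_dvd_level) (hK : ByReductionTypeAtTwo.OrdKatoHalfAtTwoIso) :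
    OrdMissingLowerBoundAtTwoIrr ↔ OrdLambdaHalfAtTwoRankZeroIrr :=
  ⟨sliceIrr_of_katoHalfIso_of_irrHalf hPub hIso.1 hK, irrHalf_of_sliceIrr hPub hAU⟩

/-- **Inside K4, 19577↾red ⟺ (19556 ↾ rank 0 ↾ red)** — modulo PUB, Cassels, Abbes–Ullmo, T2 and 19573. -/
theorem redHalf_iff_sliceRed_inside_K4
    (hPub : ByReductionTypeAtTwo.OrdPublishedInputsAtTwo) (hIso : ByReductionTypeAtTwo.OrdIsoPublishedInputsAtTwo)
    (hAU : abbesUllmo_not_dvd_maninConstant_of_not_dvd_level) (hT2 : exists_optimal_gamma1ParametrizationData)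
    (hK : ByReductionTypeAtTwo.OrdKatoHalfAtTwoIso) :
    OrdMissingLowerBoundAtTwoRed ↔ OrdLambdaHalfAtTwoRankZeroRed :=
  ⟨sliceRed_of_katoHalfIso_of_redHalf hPub hIso.1 hK, redHalf_of_sliceRed hPub hIso.1 hAU hT2⟩

/-- GEN 13's whole-slice equivalence recovered from the two halves (consistency check). -/
theorem routeDecl_iff_sliceRankZero_inside_K4
    (hPub : ByReductionTypeAtTwo.OrdPublishedInputsAtTwo) (hIso : ByReductionTypeAtTwo.OrdIsoPublishedInputsAtTwo)
    (hAU : abbesUllmo_not_dvd_maninConstant_of_not_dvd_level) (hT2 : exists_optimal_gamma1ParametrizationData)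
    (hK : ByReductionTypeAtTwo.OrdKatoHalfAtTwoIso) :
    ByReductionTypeAtTwo.OrdMissingLowerBoundAtTwo ↔ OrdLambdaHalfAtTwoRankZero := by
  rw [routeDecl_iff_irr_and_red, sliceRankZero_iff_irr_and_red, irrHalf_iff_sliceIrr_inside_K4 hPub hIso hAU hK,
    redHalf_iff_sliceRed_inside_K4 hPub hIso hAU hT2 hK]

/-! ## §3 Glue texts for a by-image re-filing (pen option; each closes at once) -/

/-- Glue text, irreducible half: PUB (19149) → Abbes–Ullmo → (19556 ↾ rank 0 ↾ irr) → 19577↾irr.  (No iso-rider, no T2.) -/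
def OrdMissingLowerBoundAtTwoIrrOfSliceIrr : Prop :=
  ByReductionTypeAtTwo.OrdPublishedInputsAtTwo → abbesUllmo_not_dvd_maninConstant_of_not_dvd_level →
    OrdLambdaHalfAtTwoRankZeroIrr → OrdMissingLowerBoundAtTwoIrr

/-- CERTIFICATE: closes at once. -/
theorem ordMissingLowerBoundAtTwoIrrOfSliceIrr_closes : OrdMissingLowerBoundAtTwoIrrOfSliceIrr :=
  fun hPub hAU hΛ0I => irrHalf_of_sliceIrr hPub hAU hΛ0I

/-- Glue text, reducible half: PUB (19149) → iso-rider (19567) → Abbes–Ullmo → T2 → (19556 ↾ rank 0 ↾ red) → 19577↾red. -/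
def OrdMissingLowerBoundAtTwoRedOfSliceRed : Prop :=
  ByReductionTypeAtTwo.OrdPublishedInputsAtTwo → ByReductionTypeAtTwo.OrdIsoPublishedInputsAtTwo →
    abbesUllmo_not_dvd_maninConstant_of_not_dvd_level → exists_optimal_gamma1ParametrizationData →
    OrdLambdaHalfAtTwoRankZeroRed → OrdMissingLowerBoundAtTwoRed

/-- CERTIFICATE: closes at once. -/
theorem ordMissingLowerBoundAtTwoRedOfSliceRed_closes : OrdMissingLowerBoundAtTwoRedOfSliceRed :=
  fun hPub hIso hAU hT2 hΛ0R => redHalf_of_sliceRed hPub hIso.1 hAU hT2 hΛ0R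

/-- Glue text, re-assembly: the two halves → ROUTE DECL (by name). -/
def OrdMissingLowerBoundAtTwoOfHalves : Prop :=
  OrdMissingLowerBoundAtTwoIrr → OrdMissingLowerBoundAtTwoRed → ByReductionTypeAtTwo.OrdMissingLowerBoundAtTwo

/-- CERTIFICATE: closes at once. -/
theorem ordMissingLowerBoundAtTwoOfHalves_closes : OrdMissingLowerBoundAtTwoOfHalves :=
  fun hI hR => routeDecl_iff_irr_and_red.mpr ⟨hI, hR⟩

/-- The pen's P3 glue text (r213, print items replaced by their definientia, r212 = 19556 in its Theses spelling) FACTORS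
through the by-image quarter glues. -/
theorem ordMissingLowerBoundAtTwoOfLambdaHalf_text_via_quarters :
    ByReductionTypeAtTwo.OrdPublishedInputsAtTwo → ByReductionTypeAtTwo.OrdIsoPublishedInputsAtTwo →
    abbesUllmo_not_dvd_maninConstant_of_not_dvd_level → exists_optimal_gamma1ParametrizationData →
    TwoAdicConverse.OrdLambdaHalfAtTwo → ByReductionTypeAtTwo.OrdMissingLowerBoundAtTwo :=
  fun hPub hIso hAU hT2 hLam =>
    ordMissingLowerBoundAtTwoOfHalves_closes
      (ordMissingLowerBoundAtTwoIrrOfSliceIrr_closes hPub hAU (quarters_of_theses hLam).1)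
      (ordMissingLowerBoundAtTwoRedOfSliceRed_closes hPub hIso hAU hT2 (quarters_of_theses hLam).2)

end Summit.BirchSwinnertonDyer.BirchSwinnertonDyer.Cruxes.OrdMissingLowerBoundAtTwo.TriageR1Seat2Gen14

end
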